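import Literature.AlgebraicGeometry.Motives.HodgeStructureCentralizerCenterFactorsFieldExtension
import Literature.AlgebraicGeometry.Motives.HodgeStructureLefschetzGroupCenterFieldExtension
import Literature.AlgebraicGeometry.Motives.HodgeStructureLefschetzGroupCenterPointsIdempotents
import HarnessLib

/-!
# `S₀(k) ≅ {IDEMPOTENTS OF C₀ ⊗ k}` IS COMPATIBLE WITH `k ⊆ k'`: `↑γ = 1 − 2e ⟹ ↑γ_{k'} = 1 − 2(e ⊗ 1)`, THE BLOCKS `V_∓(γ) = e V ∕ ker e`
# BASE-CHANGE, THE IMAGE OF `Z(S(H)(K))` IN `S(H)(L)` IS `Z(S(H)(L)) ∩ im S(H)(K)`, `#Z(S(H)(L)) = #Z(S(H)(K)) · 2^{t_L − t_K}`, AND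
# `t_L = Σ_𝔪 #(fibre over 𝔪)` (Milne 1999 §1 Remark 1.6, p. 645 `S₀`, §2 p. 646 «`1 = e₁ + ⋯ + e_t`, `V_i = e_i V`»)

[topic AlgebraicGeometry/Motives]

Layer `Literature/AlgebraicGeometry/Motives`, lane `lit-hodgefound` (Track 2 foundations library; prover seat
`lit-hodgefound-p02`, generation 56, self-proposed row g56-#6). THEOREMS ONLY: no definition, no named fact (net debt `0`),
no instance, no notation.  g55-#13 (`Motives/HodgeStructureLefschetzGroupCenterPointsIdempotents`) identified, for `†` of the
first kind, the centre `Z(S(H)(K)) = S₀(K)` with the idempotents of `Z_K = C₀ ⊗ K` through `γ = 1 − 2e` (`V₋(γ) = e(K ⊗ V)`,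
`V₊(γ) = ker e`); g56-#1 ∕ #2 ∕ #3 built, along `K → L`, the ring homomorphism `φ : Z_K → Z_L` over `j`, the injection
`Z(S(H)(K)) ↪ Z(S(H)(L))` over `γ ↦ γ_L`, and the blocks `φ(e)(L ⊗ V) = span_L j(e(K ⊗ V))`.  PROVED here (polarized `ℚ`-Hodge
structure `(H, ψ)` on a finite-dimensional `V`, fields `ℚ ⊆ K ⊆ L`, any ring homomorphism `φ : Z_K → Z_L` over `j`):
(i) `↑γ = 1 − 2e ⟺ ↑γ_L = 1 − 2E` for the `L`-extension `E` of `e` (in particular `E = φ(e)` for `e ∈ Z_K`): THE SQUARE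
`Z(S(H)(K)) ≅ Idem(Z_K) → Idem(Z_L) ≅ Z(S(H)(L))` COMMUTES, `φ` preserving and detecting idempotency;
(ii) first kind: the central `γ` with `↑γ = 1 − 2e` extends to the central `γ_L` with `↑γ_L = 1 − 2φ(e)`, and
`V₋(γ_L) = φ(e)(L ⊗ V) = span_L j(V₋(γ))`, `V₊(γ_L) = ker φ(e) = span_L j(V₊(γ))` («`V_i = e_i V`» in `k ⊆ k'`);
(iii) the image of `Z(S(H)(K))` under `S(H)(K) → S(H)(L)` is `Z(S(H)(L)) ⊓ (image of S(H)(K))` — the central `L`-points defined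
over `K`; first kind: `#Z(S(H)(L)) = #Z(S(H)(K)) · 2^{t_L − t_K}`;
(iv) `t_L = Σ_{𝔪 ∈ MaxSpec Z_K} #{𝔫 ∈ MaxSpec Z_L above 𝔪}` with every term `≥ 1` (g56-#3's surjection): `t_{k'} = Σ_i t(F_i ⊗_k k')`.

## The sources, verbatim

* J. S. Milne, *Lefschetz classes on abelian varieties*, Duke Math. J. 96 (1999) 639–675 [Milne1999LefschetzClasses] (held
  `paper:doi-10-1215-s0012-7094-99-09620-5`): folio 6 = p. 644 L30–L37 «**Remark 1.6.** … `C'(A) ≅ C(A) ⊗_k k'`,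
  `S'(A) ≅ S(A)_{/k'}`»; folio 7 = p. 645 L2–L14 «`C₀(A)` … is a product of fields … `S₀(A)(R) = {γ ∈ C₀(A) ⊗_ℚ R | γ†γ = 1}` …
  Proposition 1.7 … an isomorphism of algebraic groups `S₀(A)_{/ℚ_ℓ} → S_ℓ(A)`»; folio 8 = p. 646 L33–L40 «`F ⊗_ℚ k = F₁ × ⋯ × F_t`
  … `1 = e₁ + ⋯ + e_t` … `V(A) = V₁ ⊕ ⋯ ⊕ V_t`, `V_i = e_i V`»; §2 L1–L3 «together with their actions on `V(A)`».
* B. J. J. Moonen, Yu. G. Zarhin, *Weil classes on abelian varieties* [MoonenZarhin1998WeilClasses], §1 Lemma (1).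
* R. S. Pierce, *Associative Algebras*, GTM 88 (1982) [Pierce1982], §10.7 Cor. b.
* N. Bourbaki, *Algebra I* [BourbakiAlgebraI1989], Ch. II §5 no. 1, no. 3 Prop. 7.

Nearest tree results, BY NAME: g55-#13 `Polarization.exists_mem_center_lefschetzGroupBaseChange_coe_eq_one_sub_of_isIdempotentElem`,
`Polarization.eigenspace_neg_one_eq_range_of_coe_eq_one_sub`, `Polarization.eigenspace_one_eq_ker_of_coe_eq_one_sub`; g55-#8
`Polarization.natCard_center_lefschetzGroupBaseChange_eq_two_pow`; g56-#1 `natCard_maximalSpectrum_center_centralizer_le`; g56-#2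
`Polarization.glExtendScalars_mem_center_lefschetzGroupBaseChange(_iff)`, `coe_glExtendScalars_extendScalars`; g56-#3
`range_map_eq_span_image_extendScalars`, `injective_of_ringHom_extendScalars_comm`, `comap_maximalSpectrum_center_centralizer_surjective`.

## Dictionary and what is proved

`j = extendScalars K L V`, `γ_L = glExtendScalars K L V γ`, `Z_K = Subalgebra.center K C(H)(K)`, "`φ` over `j`" =
`∀ z x, (φ z).1.1 (j x) = j (z.1.1 x)`, `t_K = Nat.card (MaximalSpectrum Z_K)`, `2e` spelled `e + e`.

* §1 (namespace `…Motives`) `one_sub_add_self_extendScalars_comm`, **`coe_glExtendScalars_eq_one_sub_of_coe_eq_one_sub`**,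
  **`coe_eq_one_sub_of_coe_glExtendScalars_eq_one_sub`**.
* §2 (namespace `…Motives.HodgeStructure`) **`Polarization.coe_glExtendScalars_eq_one_sub_map_of_coe_eq_one_sub`** (`↑γ_L = 1 − 2φ(e)`),
  **`isIdempotentElem_map_iff_of_extendScalars_comm`**, **`Polarization.exists_mem_center_coe_glExtendScalars_eq_one_sub_map`**,
  **`Polarization.eigenspace_glExtendScalars_eq_range_map_and_ker_map`** (`V₋(γ_L) = φ(e)(L ⊗ V) = span_L j(V₋(γ))`, `V₊` likewise).
* §3 **`Polarization.map_center_lefschetzGroupBaseChange_eq_center_inf_range`**,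
  **`Polarization.natCard_center_lefschetzGroupBaseChange_eq_mul_two_pow_sub`** (`#Z_L = #Z_K · 2^{t_L − t_K}`).
* §4 **`natCard_maximalSpectrum_eq_finsum_natCard_fibre`** (`t_L = Σ_𝔪 #fibre(𝔪)`, each `≥ 1`).
-/

noncomputable section

open scoped TensorProduct

namespace Literature.AlgebraicGeometry.Motives

universe u u' v

/-! ## §1 `γ = 1 − 2e` along `j`: if `↑γ = 1 − (e + e)` then `↑γ_L = 1 − (E + E)` for the `L`-extension `E` of `e` -/

section General

variable (K : Type u) (L : Type u') [Field K] [Field L] [Algebra ℚ K] [Algebra ℚ L] [Algebra K L]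
  [IsScalarTower ℚ K L] (V : Type v) [AddCommGroup V] [Module ℚ V]

/-- `1 − (E + E)` extends `1 − (e + e)`. [cite: BourbakiAlgebraI1989, Ch. II §5 no. 1] -/
theorem one_sub_add_self_extendScalars_comm {e : Module.End K (K ⊗[ℚ] V)} {E : Module.End L (L ⊗[ℚ] V)}
    (hE : ∀ x, E (extendScalars K L V x) = extendScalars K L V (e x)) (x : K ⊗[ℚ] V) :
    (1 - (E + E)) (extendScalars K L V x) = extendScalars K L V ((1 - (e + e)) x) := by
  rw [LinearMap.sub_apply, LinearMap.sub_apply, LinearMap.add_apply, LinearMap.add_apply, Module.End.one_apply,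
    Module.End.one_apply, map_sub, map_add, hE]

/-- **`↑γ = 1 − 2e ⟹ ↑γ_L = 1 − 2E`** for `γ ∈ GL(K ⊗ V)`, `e ∈ End_K(K ⊗ V)` and the `L`-extension `E` of `e` (both sides extend `↑γ`).
[cite: Milne1999LefschetzClasses, §1 Remark 1.6 (p. 644) and §2 p. 646 L33–L38] [cite: BourbakiAlgebraI1989, Ch. II §5 no. 1] -/
theorem coe_glExtendScalars_eq_one_sub_of_coe_eq_one_sub {γ : (K ⊗[ℚ] V) ≃ₗ[K] (K ⊗[ℚ] V)} {e : Module.End K (K ⊗[ℚ] V)}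
    {E : Module.End L (L ⊗[ℚ] V)} (hE : ∀ x, E (extendScalars K L V x) = extendScalars K L V (e x))
    (hγe : (γ : Module.End K (K ⊗[ℚ] V)) = 1 - (e + e)) :
    ((glExtendScalars K L V γ : (L ⊗[ℚ] V) ≃ₗ[L] (L ⊗[ℚ] V)) : Module.End L (L ⊗[ℚ] V)) = 1 - (E + E) :=
  linearMap_eq_of_extendScalars_comm K L V (coe_glExtendScalars_extendScalars K L V γ) fun x => by
    rw [one_sub_add_self_extendScalars_comm K L V hE, ← hγe]

/-- Conversely **`↑γ_L = 1 − 2E ⟹ ↑γ = 1 − 2e`** (`j` is injective). [cite: Milne1999LefschetzClasses, §1 Remark 1.6 (p. 644)] [cite: BourbakiAlgebraI1989, Ch. II §5 no. 3 Prop. 7] -/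
theorem coe_eq_one_sub_of_coe_glExtendScalars_eq_one_sub {γ : (K ⊗[ℚ] V) ≃ₗ[K] (K ⊗[ℚ] V)} {e : Module.End K (K ⊗[ℚ] V)}
    {E : Module.End L (L ⊗[ℚ] V)} (hE : ∀ x, E (extendScalars K L V x) = extendScalars K L V (e x))
    (hγE : ((glExtendScalars K L V γ : (L ⊗[ℚ] V) ≃ₗ[L] (L ⊗[ℚ] V)) : Module.End L (L ⊗[ℚ] V)) = 1 - (E + E)) :
    (γ : Module.End K (K ⊗[ℚ] V)) = 1 - (e + e) :=
  eq_of_extendScalars_comm_of_extendScalars_comm K L V (coe_glExtendScalars_extendScalars K L V γ) fun x => by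
    rw [hγE, one_sub_add_self_extendScalars_comm K L V hE]

end General

namespace HodgeStructure

/-! ## §2 The dictionary `Z(S(H)(K)) ≅ Idem(C₀ ⊗ K)` (g55-#13) commutes with `K → L` -/

section Centre

variable (K : Type u) (L : Type u') [Field K] [Field L] [Algebra ℚ K] [Algebra ℚ L] [Algebra K L]
  [IsScalarTower ℚ K L] {V : Type v} [AddCommGroup V] [Module ℚ V] [Module.Finite ℚ V] {n : ℤ} {H : HodgeStructure V n}
  (ψ : Polarization H)

set_option maxSynthPendingDepth 4 in
omit [Module.Finite ℚ V] in
/-- **THE SQUARE `Z(S(H)(K)) ≅ Idem(Z_K) → Idem(Z_L) ≅ Z(S(H)(L))` COMMUTES**: along any ring homomorphism `φ : Z_K → Z_L` over `j`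
(g56-#1), `↑γ = 1 − 2e` with `e ∈ Z_K` gives `↑γ_L = 1 − 2φ(e)` — the idempotent of `C₀ ⊗ k'` attached to `γ_{k'}` is `e ⊗ 1`; with
g55-#13 (`γ ↦ e = ½(1 − γ)` is the bijection `Z(S(H)(K)) ≅ Idem(C₀ ⊗ K)`, first kind) and g56-#2 (`γ ↦ γ_L`).
[cite: Milne1999LefschetzClasses, §1 Remark 1.6 (p. 644), p. 645 L2–L14 (S₀, Prop. 1.7) and §2 p. 646 L33–L38] [cite: MoonenZarhin1998WeilClasses, §1 Lemma (1)] -/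
theorem Polarization.coe_glExtendScalars_eq_one_sub_map_of_coe_eq_one_sub
    (φ : Subalgebra.center K (Subalgebra.centralizer K
        ((fun a : Module.End ℚ V => a.baseChange K) '' (H.endAlg : Set (Module.End ℚ V)))) →+*
      Subalgebra.center L (Subalgebra.centralizer L
        ((fun a : Module.End ℚ V => a.baseChange L) '' (H.endAlg : Set (Module.End ℚ V)))))
    (hφ : ∀ z x, ((φ z).1.1 : Module.End L (L ⊗[ℚ] V)) (extendScalars K L V x) =
      extendScalars K L V ((z.1.1 : Module.End K (K ⊗[ℚ] V)) x))
    {γ : ψ.lefschetzGroupBaseChange K}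
    {e : Subalgebra.center K (Subalgebra.centralizer K
        ((fun a : Module.End ℚ V => a.baseChange K) '' (H.endAlg : Set (Module.End ℚ V))))}
    (hγe : ((γ : (K ⊗[ℚ] V) ≃ₗ[K] (K ⊗[ℚ] V)) : Module.End K (K ⊗[ℚ] V)) = 1 - ((e.1.1 : Module.End K (K ⊗[ℚ] V)) + e.1.1)) :
    ((glExtendScalars K L V (γ : (K ⊗[ℚ] V) ≃ₗ[K] (K ⊗[ℚ] V)) : (L ⊗[ℚ] V) ≃ₗ[L] (L ⊗[ℚ] V)) : Module.End L (L ⊗[ℚ] V)) =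
      1 - (((φ e).1.1 : Module.End L (L ⊗[ℚ] V)) + (φ e).1.1) :=
  coe_glExtendScalars_eq_one_sub_of_coe_eq_one_sub K L V (hφ e) hγe

set_option maxSynthPendingDepth 4 in
omit [Module.Finite ℚ V] in
/-- **`e ↦ φ(e)` PRESERVES AND DETECTS IDEMPOTENCY** (`φ` is an injective ring homomorphism): the idempotents of `C₀ ⊗ K` embed into
those of `C₀ ⊗ L` (`e ↦ e ⊗ 1`). [cite: Milne1999LefschetzClasses, §1 Remark 1.6 (p. 644) and §2 p. 646 L33–L38] [cite: Pierce1982, §10.7 Cor. b] -/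
theorem isIdempotentElem_map_iff_of_extendScalars_comm
    (φ : Subalgebra.center K (Subalgebra.centralizer K
        ((fun a : Module.End ℚ V => a.baseChange K) '' (H.endAlg : Set (Module.End ℚ V)))) →+*
      Subalgebra.center L (Subalgebra.centralizer L
        ((fun a : Module.End ℚ V => a.baseChange L) '' (H.endAlg : Set (Module.End ℚ V)))))
    (hφ : ∀ z x, ((φ z).1.1 : Module.End L (L ⊗[ℚ] V)) (extendScalars K L V x) =
      extendScalars K L V ((z.1.1 : Module.End K (K ⊗[ℚ] V)) x))
    (e : Subalgebra.center K (Subalgebra.centralizer K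
        ((fun a : Module.End ℚ V => a.baseChange K) '' (H.endAlg : Set (Module.End ℚ V))))) :
    IsIdempotentElem (φ e) ↔ IsIdempotentElem e := by
  refine ⟨fun h => ?_, fun h => h.map φ⟩
  have hinj := injective_of_ringHom_extendScalars_comm K L H φ hφ
  exact hinj (by rw [map_mul, h.eq])

set_option maxSynthPendingDepth 4 in
/-- **FIRST KIND: THE CENTRAL `γ_L` ATTACHED (g55-#13 over `L`) TO THE IDEMPOTENT `φ(e)` IS THE EXTENSION OF THE CENTRAL `γ` ATTACHED TO
`e`** — existence-and-uniqueness packaging: for every idempotent `e ∈ Z_K` there is a central `γ ∈ S(H)(K)` with `↑γ = 1 − 2e`, and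
then `γ_L` is central in `S(H)(L)` with `↑γ_L = 1 − 2φ(e)`. [cite: Milne1999LefschetzClasses, §1 Remark 1.6 (p. 644), p. 645 L2–L14 and §2 p. 646 L33–L38]
[cite: MoonenZarhin1998WeilClasses, §1 Lemma (1)] -/
theorem Polarization.exists_mem_center_coe_glExtendScalars_eq_one_sub_map
    (hfix : ∀ z : H.endAlg, z ∈ Subalgebra.center ℚ H.endAlg → ψ.adjoint (z : Module.End ℚ V) = z)
    (φ : Subalgebra.center K (Subalgebra.centralizer K
        ((fun a : Module.End ℚ V => a.baseChange K) '' (H.endAlg : Set (Module.End ℚ V)))) →+*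
      Subalgebra.center L (Subalgebra.centralizer L
        ((fun a : Module.End ℚ V => a.baseChange L) '' (H.endAlg : Set (Module.End ℚ V)))))
    (hφ : ∀ z x, ((φ z).1.1 : Module.End L (L ⊗[ℚ] V)) (extendScalars K L V x) =
      extendScalars K L V ((z.1.1 : Module.End K (K ⊗[ℚ] V)) x))
    {e : Subalgebra.center K (Subalgebra.centralizer K
        ((fun a : Module.End ℚ V => a.baseChange K) '' (H.endAlg : Set (Module.End ℚ V))))} (he : IsIdempotentElem e) :
    ∃ γ : ψ.lefschetzGroupBaseChange K, γ ∈ Subgroup.center (ψ.lefschetzGroupBaseChange K) ∧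
      ((γ : (K ⊗[ℚ] V) ≃ₗ[K] (K ⊗[ℚ] V)) : Module.End K (K ⊗[ℚ] V)) = 1 - ((e.1.1 : Module.End K (K ⊗[ℚ] V)) + e.1.1) ∧
      (⟨glExtendScalars K L V (γ : (K ⊗[ℚ] V) ≃ₗ[K] (K ⊗[ℚ] V)),
          (ψ.glExtendScalars_mem_lefschetzGroupBaseChange_iff K L _).2 γ.2⟩ : ψ.lefschetzGroupBaseChange L) ∈
        Subgroup.center (ψ.lefschetzGroupBaseChange L) ∧
      ((glExtendScalars K L V (γ : (K ⊗[ℚ] V) ≃ₗ[K] (K ⊗[ℚ] V)) : (L ⊗[ℚ] V) ≃ₗ[L] (L ⊗[ℚ] V)) : Module.End L (L ⊗[ℚ] V)) =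
        1 - (((φ e).1.1 : Module.End L (L ⊗[ℚ] V)) + (φ e).1.1) := by
  obtain ⟨γ, hγ, hγe⟩ := ψ.exists_mem_center_lefschetzGroupBaseChange_coe_eq_one_sub_of_isIdempotentElem K hfix he
  exact ⟨γ, hγ, hγe, ψ.glExtendScalars_mem_center_lefschetzGroupBaseChange K L hγ,
    ψ.coe_glExtendScalars_eq_one_sub_map_of_coe_eq_one_sub K L φ hφ hγe⟩

set_option maxSynthPendingDepth 4 in
omit [Module.Finite ℚ V] in
/-- **THE BLOCKS FOLLOW: `V₋(γ_L) = φ(e)(L ⊗ V) = span_L j(e(K ⊗ V)) = span_L j(V₋(γ))` and `V₊(γ_L) = ker φ(e) = span_L j(ker e)`**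
for `↑γ = 1 − 2e`, `e ∈ Z_K` idempotent (g55-#13's `V₋ = range e`, `V₊ = ker e`, over `K` and over `L`, with g56-#3's blocks along `j`).
[cite: Milne1999LefschetzClasses, §1 Remark 1.6 (p. 644) and §2 p. 646 L33–L40 (`V_i = e_i V`)] -/
theorem Polarization.eigenspace_glExtendScalars_eq_range_map_and_ker_map
    (φ : Subalgebra.center K (Subalgebra.centralizer K
        ((fun a : Module.End ℚ V => a.baseChange K) '' (H.endAlg : Set (Module.End ℚ V)))) →+*
      Subalgebra.center L (Subalgebra.centralizer L
        ((fun a : Module.End ℚ V => a.baseChange L) '' (H.endAlg : Set (Module.End ℚ V)))))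
    (hφ : ∀ z x, ((φ z).1.1 : Module.End L (L ⊗[ℚ] V)) (extendScalars K L V x) =
      extendScalars K L V ((z.1.1 : Module.End K (K ⊗[ℚ] V)) x))
    {γ : ψ.lefschetzGroupBaseChange K}
    {e : Subalgebra.center K (Subalgebra.centralizer K
        ((fun a : Module.End ℚ V => a.baseChange K) '' (H.endAlg : Set (Module.End ℚ V))))} (he : IsIdempotentElem e)
    (hγe : ((γ : (K ⊗[ℚ] V) ≃ₗ[K] (K ⊗[ℚ] V)) : Module.End K (K ⊗[ℚ] V)) = 1 - ((e.1.1 : Module.End K (K ⊗[ℚ] V)) + e.1.1)) :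
    Module.End.eigenspace ((glExtendScalars K L V (γ : (K ⊗[ℚ] V) ≃ₗ[K] (K ⊗[ℚ] V)) : (L ⊗[ℚ] V) ≃ₗ[L] (L ⊗[ℚ] V)) :
        Module.End L (L ⊗[ℚ] V)) (-1) = LinearMap.range ((φ e).1.1 : Module.End L (L ⊗[ℚ] V)) ∧
      LinearMap.range ((φ e).1.1 : Module.End L (L ⊗[ℚ] V)) =
        Submodule.span L (extendScalars K L V '' (LinearMap.range (e.1.1 : Module.End K (K ⊗[ℚ] V)) : Set (K ⊗[ℚ] V))) ∧
      Module.End.eigenspace ((glExtendScalars K L V (γ : (K ⊗[ℚ] V) ≃ₗ[K] (K ⊗[ℚ] V)) : (L ⊗[ℚ] V) ≃ₗ[L] (L ⊗[ℚ] V)) :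
        Module.End L (L ⊗[ℚ] V)) 1 = LinearMap.ker ((φ e).1.1 : Module.End L (L ⊗[ℚ] V)) ∧
      LinearMap.ker ((φ e).1.1 : Module.End L (L ⊗[ℚ] V)) =
        Submodule.span L (extendScalars K L V '' (LinearMap.ker (e.1.1 : Module.End K (K ⊗[ℚ] V)) : Set (K ⊗[ℚ] V))) := by
  have hγL := ψ.coe_glExtendScalars_eq_one_sub_map_of_coe_eq_one_sub K L φ hφ hγe
  have he' : IsIdempotentElem ((φ e).1.1 : Module.End L (L ⊗[ℚ] V)) := by
    have h := (he.map φ).eq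
    exact congrArg (fun w : Subalgebra.center L (Subalgebra.centralizer L
      ((fun a : Module.End ℚ V => a.baseChange L) '' (H.endAlg : Set (Module.End ℚ V)))) => (w.1.1 : Module.End L (L ⊗[ℚ] V))) h
  have hblocks := range_map_eq_span_image_extendScalars K L H φ hφ e
  refine ⟨?_, hblocks.1, ?_, hblocks.2 he⟩
  · exact ψ.eigenspace_neg_one_eq_range_of_coe_eq_one_sub L
      (γ := ⟨glExtendScalars K L V (γ : (K ⊗[ℚ] V) ≃ₗ[K] (K ⊗[ℚ] V)), (ψ.glExtendScalars_mem_lefschetzGroupBaseChange_iff K L _).2 γ.2⟩)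
      he' hγL
  · exact ψ.eigenspace_one_eq_ker_of_coe_eq_one_sub L
      (γ := ⟨glExtendScalars K L V (γ : (K ⊗[ℚ] V) ≃ₗ[K] (K ⊗[ℚ] V)), (ψ.glExtendScalars_mem_lefschetzGroupBaseChange_iff K L _).2 γ.2⟩)
      hγL

/-! ## §3 The image of `Z(S(H)(K))` in `S(H)(L)`: `Z(S(H)(L)) ∩ (image of S(H)(K))`; sizes `2^{t_L} = 2^{t_K} · 2^{t_L − t_K}`; fibres -/

/-- **THE IMAGE OF `Z(S(H)(K))` UNDER `S(H)(K) → S(H)(L)` IS `Z(S(H)(L)) ∩ (IMAGE OF S(H)(K))`** — the central `L`-points defined over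
`K` (g56-#2 `γ_L ∈ Z(S(H)(L)) ⟺ γ ∈ Z(S(H)(K))`). [cite: Milne1999LefschetzClasses, §1 Remark 1.6 (p. 644) and p. 645 L2–L6 (`S₀`)] -/
theorem Polarization.map_center_lefschetzGroupBaseChange_eq_center_inf_range :
    (Subgroup.center (ψ.lefschetzGroupBaseChange K)).map
        (((glExtendScalarsHom K L V).restrict (ψ.lefschetzGroupBaseChange K)).codRestrict (ψ.lefschetzGroupBaseChange L)
          fun γ => (ψ.glExtendScalars_mem_lefschetzGroupBaseChange_iff K L _).2 γ.2) =
      Subgroup.center (ψ.lefschetzGroupBaseChange L) ⊓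
        (((glExtendScalarsHom K L V).restrict (ψ.lefschetzGroupBaseChange K)).codRestrict (ψ.lefschetzGroupBaseChange L)
          fun γ => (ψ.glExtendScalars_mem_lefschetzGroupBaseChange_iff K L _).2 γ.2).range := by
  ext δ
  rw [Subgroup.mem_map, Subgroup.mem_inf, MonoidHom.mem_range]
  constructor
  · rintro ⟨γ, hγ, rfl⟩
    exact ⟨(ψ.glExtendScalars_mem_center_lefschetzGroupBaseChange_iff K L γ).2 hγ, γ, rfl⟩
  · rintro ⟨hδ, γ, rfl⟩
    exact ⟨γ, (ψ.glExtendScalars_mem_center_lefschetzGroupBaseChange_iff K L γ).1 hδ, rfl⟩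

set_option maxSynthPendingDepth 4 in
/-- **FIRST KIND: `#Z(S(H)(L)) = #Z(S(H)(K)) · 2^{t_L − t_K}`** (`2^{t_L} = 2^{t_K} · 2^{t_L − t_K}`, `t_K ≤ t_L` by g56-#1): the index of the
`K`-rational central points among the `L`-rational ones. [cite: Milne1999LefschetzClasses, §1 Remark 1.6 (p. 644), p. 645 L2–L14 and §2 p. 646 L33–L38] -/
theorem Polarization.natCard_center_lefschetzGroupBaseChange_eq_mul_two_pow_sub
    (hfix : ∀ z : H.endAlg, z ∈ Subalgebra.center ℚ H.endAlg → ψ.adjoint (z : Module.End ℚ V) = z) :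
    Nat.card (Subgroup.center (ψ.lefschetzGroupBaseChange L)) =
      Nat.card (Subgroup.center (ψ.lefschetzGroupBaseChange K)) *
        2 ^ (Nat.card (MaximalSpectrum (Subalgebra.center L (Subalgebra.centralizer L
            ((fun a : Module.End ℚ V => a.baseChange L) '' (H.endAlg : Set (Module.End ℚ V)))))) -
          Nat.card (MaximalSpectrum (Subalgebra.center K (Subalgebra.centralizer K
            ((fun a : Module.End ℚ V => a.baseChange K) '' (H.endAlg : Set (Module.End ℚ V))))))) := by
  rw [ψ.natCard_center_lefschetzGroupBaseChange_eq_two_pow K hfix, ψ.natCard_center_lefschetzGroupBaseChange_eq_two_pow L hfix, ← pow_add,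
    Nat.add_sub_cancel' (natCard_maximalSpectrum_center_centralizer_le K L H ⟨ψ⟩)]

end Centre

/-! ## §4 `t_L = Σ_{𝔪} #(fibre over 𝔪)`: each factor `F_i` of `C₀ ⊗ K` contributes the number of factors of `F_i ⊗_K L` -/

section Fibres

variable (K : Type u) (L : Type u') [Field K] [Field L] [Algebra ℚ K] [Algebra ℚ L] [Algebra K L]
  [IsScalarTower ℚ K L] {V : Type v} [AddCommGroup V] [Module ℚ V] [Module.Finite ℚ V] {n : ℤ} (H : HodgeStructure V n)

set_option maxSynthPendingDepth 4 in
/-- **`t_L = Σ_{𝔪 ∈ MaxSpec(Z_K)} #{𝔫 ∈ MaxSpec(Z_L) above 𝔪}` WITH EVERY TERM `≥ 1`** (the contraction `MaxSpec(Z_L) → MaxSpec(Z_K)` of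
g56-#3 is surjective): `t_{k'} = Σ_i t(F_i ⊗_k k')` for `F ⊗_ℚ k = F₁ × ⋯ × F_t`. [cite: Milne1999LefschetzClasses, §1 Remark 1.6 (p. 644) and §2 p. 646 L33–L38]
[cite: Pierce1982, §10.7 Cor. b] -/
theorem natCard_maximalSpectrum_eq_finsum_natCard_fibre (hH : H.IsPolarizable)
    (φ : Subalgebra.center K (Subalgebra.centralizer K
        ((fun a : Module.End ℚ V => a.baseChange K) '' (H.endAlg : Set (Module.End ℚ V)))) →+*
      Subalgebra.center L (Subalgebra.centralizer L
        ((fun a : Module.End ℚ V => a.baseChange L) '' (H.endAlg : Set (Module.End ℚ V)))))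
    (hφ : ∀ z x, ((φ z).1.1 : Module.End L (L ⊗[ℚ] V)) (extendScalars K L V x) =
      extendScalars K L V ((z.1.1 : Module.End K (K ⊗[ℚ] V)) x)) :
    ∃ hmax : ∀ I' : MaximalSpectrum (Subalgebra.center L (Subalgebra.centralizer L
        ((fun a : Module.End ℚ V => a.baseChange L) '' (H.endAlg : Set (Module.End ℚ V))))), (I'.asIdeal.comap φ).IsMaximal,
      Nat.card (MaximalSpectrum (Subalgebra.center L (Subalgebra.centralizer L
          ((fun a : Module.End ℚ V => a.baseChange L) '' (H.endAlg : Set (Module.End ℚ V)))))) =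
        ∑ᶠ I : MaximalSpectrum (Subalgebra.center K (Subalgebra.centralizer K
            ((fun a : Module.End ℚ V => a.baseChange K) '' (H.endAlg : Set (Module.End ℚ V))))),
          Nat.card {I' : MaximalSpectrum (Subalgebra.center L (Subalgebra.centralizer L
            ((fun a : Module.End ℚ V => a.baseChange L) '' (H.endAlg : Set (Module.End ℚ V))))) //
              (⟨I'.asIdeal.comap φ, hmax I'⟩ : MaximalSpectrum (Subalgebra.center K (Subalgebra.centralizer K
                ((fun a : Module.End ℚ V => a.baseChange K) '' (H.endAlg : Set (Module.End ℚ V)))))) = I} ∧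
      ∀ I : MaximalSpectrum (Subalgebra.center K (Subalgebra.centralizer K
          ((fun a : Module.End ℚ V => a.baseChange K) '' (H.endAlg : Set (Module.End ℚ V))))),
        1 ≤ Nat.card {I' : MaximalSpectrum (Subalgebra.center L (Subalgebra.centralizer L
            ((fun a : Module.End ℚ V => a.baseChange L) '' (H.endAlg : Set (Module.End ℚ V))))) //
              (⟨I'.asIdeal.comap φ, hmax I'⟩ : MaximalSpectrum (Subalgebra.center K (Subalgebra.centralizer K
                ((fun a : Module.End ℚ V => a.baseChange K) '' (H.endAlg : Set (Module.End ℚ V)))))) = I} := by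
  obtain ⟨hmax, hsurj⟩ := comap_maximalSpectrum_center_centralizer_surjective K L H hH φ hφ
  haveI := finite_maximalSpectrum_center_centralizer_endAlg_baseChange K (H := H)
  haveI := finite_maximalSpectrum_center_centralizer_endAlg_baseChange L (H := H)
  haveI := Fintype.ofFinite (MaximalSpectrum (Subalgebra.center K (Subalgebra.centralizer K
    ((fun a : Module.End ℚ V => a.baseChange K) '' (H.endAlg : Set (Module.End ℚ V))))))
  refine ⟨hmax, ?_, fun I => ?_⟩
  · rw [finsum_eq_sum_of_fintype, ← Nat.card_sigma, Nat.card_congr (Equiv.sigmaFiberEquiv _)]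
  · obtain ⟨I', hI'⟩ := hsurj I
    haveI : Nonempty {I' : MaximalSpectrum (Subalgebra.center L (Subalgebra.centralizer L
        ((fun a : Module.End ℚ V => a.baseChange L) '' (H.endAlg : Set (Module.End ℚ V))))) //
          (⟨I'.asIdeal.comap φ, hmax I'⟩ : MaximalSpectrum (Subalgebra.center K (Subalgebra.centralizer K
            ((fun a : Module.End ℚ V => a.baseChange K) '' (H.endAlg : Set (Module.End ℚ V)))))) = I} := ⟨⟨I', hI'⟩⟩
    haveI : Finite {I' : MaximalSpectrum (Subalgebra.center L (Subalgebra.centralizer L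
        ((fun a : Module.End ℚ V => a.baseChange L) '' (H.endAlg : Set (Module.End ℚ V))))) //
          (⟨I'.asIdeal.comap φ, hmax I'⟩ : MaximalSpectrum (Subalgebra.center K (Subalgebra.centralizer K
            ((fun a : Module.End ℚ V => a.baseChange K) '' (H.endAlg : Set (Module.End ℚ V)))))) = I} := Subtype.finite
    exact Nat.one_le_iff_ne_zero.2 Nat.card_pos.ne'

end Fibres

end HodgeStructure

end Literature.AlgebraicGeometry.Motives
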